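import Mathlib
import HarnessLib
import Literature.Analysis.FluidPDE.KochTataru
import Literature.Analysis.FluidPDE.NSBoundedMildOseen
import Literature.Analysis.FluidPDE.OseenDuhamelLowFrequency
import Summits.NavierStokesRegularity.NavierStokesRegularity.Theorems.QuarterLogPincerQuietCollarOseenHalfMoment
import Summits.NavierStokesRegularity.NavierStokesRegularity.Theorems.QuarterLogPincerQuietCollarOseenCommutatorSup
import Summits.NavierStokesRegularity.NavierStokesRegularity.Theorems.QuarterLogPincerQuietCoreRecedingTools

/-!
# Route `QuarterLogPincer`, crux `TypeIQuantSubcubicExp` (stmt-NavierStokesRegularity-24077), line `quiet_collar` — towards QP2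
# (log-weighted typing `StubCutPairLog`), module M1b-dom: POINTWISE DOMINATION OF THE OSEEN COMMUTATOR BY `L³`-CONTROLLED MAJORANTS

The `L³` clause of QP2 bounds the mild defect of the cut reference by `K₂(b+1)`, `b` the LOCAL budget `‖1_{B(0,R)}v(s)‖₃`.  For the
Oseen commutator `O(t,x) = χ(x)B₀(u,u)(t,x) − B₀(χu,χu)(t,x)` (`u = v(·−1)`, `χ = radialCutoff r (r+L)`, vanishing off `B(0,ρ)`,
`ρ = r+L < R`) this file proves the pointwise domination that feeds Minkowski + Young (module M1b-L³):

`‖O(t,x)‖ ≤ Lχ^{1/2}·∫∫ k(t−τ,x−y)‖x−y‖^{1/2}·F + η_c·∫∫ k(t−τ,x−y)·G + 1_{B(0,ρ)}(x)·C_K·A²·(4π/(R−ρ))·t`,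

`F(τ,y) = 1_{B(0,R)}(y)‖u(τ,y)‖²`, `G(τ,y) = 1_{B(0,R)}(y)‖u(τ,y)‖` (both `L³`-controlled by `b`), `k` the Oseen majorant:
the COMMUTATOR part for `y ∈ B(0,R)` carries the gain `|χ(x)−χ(y)| ≤ (Lχ‖x−y‖)^{1/2}`, the TRANSITION part `χ(1−χ)` lives on the
quiet layer (`‖u‖ ≤ η_c` there, so `‖u‖² ≤ η_c‖u‖`), and the FAR part `y ∉ B(0,R)` only sees `x ∈ B(0,ρ)` at distance
`≥ R − ρ`, where `k(σ,z) ≤ C_K‖z‖⁻⁴` integrates to `4πC_K/(R−ρ)` (`…QuietCore….integral_indicator_compl_ball_norm_rpow_neg_four`).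

* `norm_commutatorIntegrand_le_three` — the pointwise split of the integrand;
* `enorm_oseenCommutator_le_lintegral` — the domination of `‖O(t,x)‖ₑ` by the three `ℝ≥0∞`-integrals.

r-INDEPENDENT groundwork for QP2 (DIRECTOR-NS KEY-NS #187).  HONEST FRAME: kernel bookkeeping about a hypothetical field;
nothing here bears on 24077, W7 or Navier–Stokes regularity (OPEN).  pub-ns-dss typer (g37), `--supports 24077`.
-/

noncomputable section

set_option linter.dupNamespace false

namespace Summit.NavierStokesRegularity.NavierStokesRegularity.Cruxes.TypeIQuantSubcubicExp.QuietCollar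

open MeasureTheory Set Function Filter Real Metric
open scoped ENNReal NNReal Topology
open Literature.Analysis Literature.Analysis.FluidPDE
open Summit.NavierStokesRegularity.NavierStokesRegularity.Cruxes.TypeIQuantSubcubicExp.QuietCore
  (integral_indicator_compl_ball_norm_rpow_neg_four integrable_indicator_compl_ball_norm_rpow_neg_four)

/-- The Oseen majorant on `ℝ³` is `C_K (σ + ‖z‖²)⁻²`. [folklore] -/
theorem oseenMajorant_fin_three (σ : ℝ) (z : EuclideanSpace ℝ (Fin 3)) :
    oseenMajorant (EuclideanSpace ℝ (Fin 3)) σ z = oseenKernelBoundConst (EuclideanSpace ℝ (Fin 3)) * (σ + ‖z‖ ^ 2) ^ (-(2 : ℝ)) := by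
  unfold oseenMajorant; rw [oseen_exponent_fin_three]

/-- **FAR BOUND OF THE MAJORANT**: `k(σ,z) ≤ C_K‖z‖⁻⁴` for `σ ≥ 0`, `z ≠ 0`. [folklore] -/
theorem oseenMajorant_le_norm_rpow_neg_four {σ : ℝ} (hσ : 0 ≤ σ) {z : EuclideanSpace ℝ (Fin 3)} (hz : z ≠ 0) :
    oseenMajorant (EuclideanSpace ℝ (Fin 3)) σ z ≤ oseenKernelBoundConst (EuclideanSpace ℝ (Fin 3)) * ‖z‖ ^ (-(4 : ℝ)) := by
  rw [oseenMajorant_fin_three]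
  refine mul_le_mul_of_nonneg_left ?_ oseenKernelBoundConst_pos.le
  have hz2 : 0 < ‖z‖ ^ 2 := by positivity
  calc (σ + ‖z‖ ^ 2) ^ (-(2 : ℝ)) ≤ (‖z‖ ^ 2) ^ (-(2 : ℝ)) :=
        Real.rpow_le_rpow_of_nonpos hz2 (by linarith) (by norm_num)
    _ = ‖z‖ ^ (-(4 : ℝ)) := by
        rw [← Real.rpow_natCast, ← Real.rpow_mul (norm_nonneg _)]; norm_num

/-- **THE POINTWISE SPLIT OF THE COMMUTATOR INTEGRAND** (commutator / transition / far): for `0 ≤ χ ≤ 1`, `Lχ`-Lipschitz,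
vanishing off `B(0,ρ)`, `ρ < R`, a vector `a` with `‖a‖ ≤ A` and `‖a‖ ≤ η_c` if `0 < χ(y) < 1`, and `σ > 0`:
`‖(χ(x) − χ(y)²)K(σ,x−y)[a,a]‖ ≤ Lχ^{1/2}·k(σ,x−y)‖x−y‖^{1/2}·1_{B(0,R)}(y)‖a‖² + η_c·k(σ,x−y)·1_{B(0,R)}(y)‖a‖
 + 1_{B(0,ρ)}(x)·C_K·A²·1_{‖x−y‖ ≥ R−ρ}‖x−y‖⁻⁴`. [folklore] -/
theorem norm_commutatorIntegrand_le_three {χ : EuclideanSpace ℝ (Fin 3) → ℝ} {Lχ A ηc σ ρ R : ℝ} {a : EuclideanSpace ℝ (Fin 3)}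
    (h0 : ∀ z, 0 ≤ χ z) (h1 : ∀ z, χ z ≤ 1) (hL : 0 ≤ Lχ) (hLip : ∀ x y, |χ x - χ y| ≤ Lχ * ‖x - y‖)
    (hχρ : ∀ z : EuclideanSpace ℝ (Fin 3), ρ ≤ ‖z‖ → χ z = 0) (hρR : ρ < R) (hσ : 0 < σ) (hA : ‖a‖ ≤ A) (hηc : 0 ≤ ηc)
    {y : EuclideanSpace ℝ (Fin 3)} (hquiet : 0 < χ y → χ y < 1 → ‖a‖ ≤ ηc) (x : EuclideanSpace ℝ (Fin 3)) :
    ‖(χ x - χ y * χ y) • oseenKernel σ (x - y) a a‖ ≤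
      Lχ ^ (1 / 2 : ℝ) * (oseenMajorant (EuclideanSpace ℝ (Fin 3)) σ (x - y) * ‖x - y‖ ^ (1 / 2 : ℝ) *
          (Metric.ball (0 : EuclideanSpace ℝ (Fin 3)) R).indicator (fun _ => ‖a‖ ^ 2) y) +
        ηc * (oseenMajorant (EuclideanSpace ℝ (Fin 3)) σ (x - y) * (Metric.ball (0 : EuclideanSpace ℝ (Fin 3)) R).indicator (fun _ => ‖a‖) y) +
        (Metric.ball (0 : EuclideanSpace ℝ (Fin 3)) ρ).indicator (fun _ => (1 : ℝ)) x *
          (oseenKernelBoundConst (EuclideanSpace ℝ (Fin 3)) * A ^ 2 *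
            (Metric.ball (0 : EuclideanSpace ℝ (Fin 3)) (R - ρ))ᶜ.indicator (fun z => ‖z‖ ^ (-(4 : ℝ))) (x - y)) := by
  have hA0 : 0 ≤ A := (norm_nonneg _).trans hA
  have hk0 : 0 ≤ oseenMajorant (EuclideanSpace ℝ (Fin 3)) σ (x - y) := oseenMajorant_nonneg hσ.le _
  have hK : ‖oseenKernel σ (x - y) a a‖ ≤ oseenMajorant (EuclideanSpace ℝ (Fin 3)) σ (x - y) * ‖a‖ * ‖a‖ :=
    norm_oseenKernel_le_oseenMajorant hσ _ _ _
  -- nonnegativity of the three right-hand terms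
  have hT1 : 0 ≤ Lχ ^ (1 / 2 : ℝ) * (oseenMajorant (EuclideanSpace ℝ (Fin 3)) σ (x - y) * ‖x - y‖ ^ (1 / 2 : ℝ) *
      (Metric.ball (0 : EuclideanSpace ℝ (Fin 3)) R).indicator (fun _ => ‖a‖ ^ 2) y) := by
    have : 0 ≤ (Metric.ball (0 : EuclideanSpace ℝ (Fin 3)) R).indicator (fun _ => ‖a‖ ^ 2) y :=
      Set.indicator_nonneg (fun _ _ => by positivity) _
    positivity
  have hT2 : 0 ≤ ηc * (oseenMajorant (EuclideanSpace ℝ (Fin 3)) σ (x - y) *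
      (Metric.ball (0 : EuclideanSpace ℝ (Fin 3)) R).indicator (fun _ => ‖a‖) y) := by
    have : 0 ≤ (Metric.ball (0 : EuclideanSpace ℝ (Fin 3)) R).indicator (fun _ => ‖a‖) y :=
      Set.indicator_nonneg (fun _ _ => norm_nonneg _) _
    positivity
  have hT3 : 0 ≤ (Metric.ball (0 : EuclideanSpace ℝ (Fin 3)) ρ).indicator (fun _ => (1 : ℝ)) x *
      (oseenKernelBoundConst (EuclideanSpace ℝ (Fin 3)) * A ^ 2 *
        (Metric.ball (0 : EuclideanSpace ℝ (Fin 3)) (R - ρ))ᶜ.indicator (fun z => ‖z‖ ^ (-(4 : ℝ))) (x - y)) := by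
    have h1' : 0 ≤ (Metric.ball (0 : EuclideanSpace ℝ (Fin 3)) ρ).indicator (fun _ => (1 : ℝ)) x :=
      Set.indicator_nonneg (fun _ _ => zero_le_one) _
    have h2' : 0 ≤ (Metric.ball (0 : EuclideanSpace ℝ (Fin 3)) (R - ρ))ᶜ.indicator (fun z => ‖z‖ ^ (-(4 : ℝ))) (x - y) :=
      Set.indicator_nonneg (fun _ _ => Real.rpow_nonneg (norm_nonneg _) _) _
    have := oseenKernelBoundConst_pos (E := EuclideanSpace ℝ (Fin 3))
    positivity
  by_cases hyR : y ∈ Metric.ball (0 : EuclideanSpace ℝ (Fin 3)) R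
  · -- near: commutator + transition
    rw [Set.indicator_of_mem hyR, Set.indicator_of_mem hyR]
    have hcomm : |χ x - χ y| * (‖a‖ * ‖a‖) ≤ Lχ ^ (1 / 2 : ℝ) * ‖x - y‖ ^ (1 / 2 : ℝ) * ‖a‖ ^ 2 := by
      have hmin : |χ x - χ y| ≤ min 1 (Lχ * ‖x - y‖) := by
        refine le_min ?_ (hLip x y)
        rw [abs_le]; constructor <;> linarith [h0 x, h1 x, h0 y, h1 y]
      have h2 : min 1 (Lχ * ‖x - y‖) ≤ Lχ ^ (1 / 2 : ℝ) * ‖x - y‖ ^ (1 / 2 : ℝ) := by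
        rw [← Real.mul_rpow hL (norm_nonneg _)]; exact min_one_le_rpow_half (by positivity)
      rw [sq]
      exact mul_le_mul_of_nonneg_right (hmin.trans h2) (by positivity)
    have htrans : χ y * (1 - χ y) * (‖a‖ * ‖a‖) ≤ ηc * ‖a‖ := by
      by_cases hy0 : 0 < χ y
      · by_cases hy1 : χ y < 1
        · have hq := hquiet hy0 hy1
          have h3 : χ y * (1 - χ y) ≤ 1 := by nlinarith [h0 y, h1 y]
          have h4 : 0 ≤ χ y * (1 - χ y) := mul_nonneg (h0 y) (by linarith [h1 y])
          calc χ y * (1 - χ y) * (‖a‖ * ‖a‖) ≤ 1 * (ηc * ‖a‖) :=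
                mul_le_mul h3 (mul_le_mul_of_nonneg_right hq (norm_nonneg _)) (by positivity) zero_le_one
            _ = ηc * ‖a‖ := one_mul _
        · have : χ y = 1 := le_antisymm (h1 y) (not_lt.1 hy1)
          rw [this]; simp; positivity
      · have : χ y = 0 := le_antisymm (not_lt.1 hy0) (h0 y)
        rw [this]; simp; positivity
    rw [norm_smul, Real.norm_eq_abs]
    calc |χ x - χ y * χ y| * ‖oseenKernel σ (x - y) a a‖
        ≤ (|χ x - χ y| + χ y * (1 - χ y)) * (oseenMajorant (EuclideanSpace ℝ (Fin 3)) σ (x - y) * ‖a‖ * ‖a‖) :=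
          mul_le_mul (abs_weight_le h0 h1 x y) hK (norm_nonneg _)
            (add_nonneg (abs_nonneg _) (mul_nonneg (h0 y) (by linarith [h1 y])))
      _ = oseenMajorant (EuclideanSpace ℝ (Fin 3)) σ (x - y) *
            (|χ x - χ y| * (‖a‖ * ‖a‖) + χ y * (1 - χ y) * (‖a‖ * ‖a‖)) := by ring
      _ ≤ oseenMajorant (EuclideanSpace ℝ (Fin 3)) σ (x - y) *
            (Lχ ^ (1 / 2 : ℝ) * ‖x - y‖ ^ (1 / 2 : ℝ) * ‖a‖ ^ 2 + ηc * ‖a‖) :=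
          mul_le_mul_of_nonneg_left (add_le_add hcomm htrans) hk0
      _ = Lχ ^ (1 / 2 : ℝ) * (oseenMajorant (EuclideanSpace ℝ (Fin 3)) σ (x - y) * ‖x - y‖ ^ (1 / 2 : ℝ) * ‖a‖ ^ 2) +
            ηc * (oseenMajorant (EuclideanSpace ℝ (Fin 3)) σ (x - y) * ‖a‖) := by ring
      _ ≤ _ := le_add_of_nonneg_right hT3
  · -- far: `χ y = 0`, only `x ∈ B(0,ρ)` matters, at distance `≥ R − ρ`
    rw [Metric.mem_ball, dist_zero_right, not_lt] at hyR
    have hχy : χ y = 0 := hχρ y (le_trans hρR.le hyR)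
    rw [hχy, mul_zero, sub_zero]
    by_cases hχx : χ x = 0
    · rw [hχx, zero_smul, norm_zero]; exact add_nonneg (add_nonneg hT1 hT2) hT3
    · have hxρ : ‖x‖ < ρ := by
        by_contra hcon; exact hχx (hχρ x (not_lt.1 hcon))
      have hxmem : x ∈ Metric.ball (0 : EuclideanSpace ℝ (Fin 3)) ρ := by rw [Metric.mem_ball, dist_zero_right]; exact hxρ
      have hdist : R - ρ ≤ ‖x - y‖ := by
        have := norm_sub_norm_le y x
        rw [norm_sub_rev] at this
        linarith
      have hzmem : x - y ∈ (Metric.ball (0 : EuclideanSpace ℝ (Fin 3)) (R - ρ))ᶜ := by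
        rw [Set.mem_compl_iff, Metric.mem_ball, dist_zero_right, not_lt]; exact hdist
      have hz : x - y ≠ 0 := by
        intro h0'
        rw [h0', norm_zero] at hdist
        linarith
      refine le_trans ?_ (le_add_of_nonneg_left (add_nonneg hT1 hT2))
      rw [Set.indicator_of_mem hxmem, Set.indicator_of_mem hzmem, one_mul, norm_smul, Real.norm_eq_abs]
      have hχx1 : |χ x| ≤ 1 := by rw [abs_le]; constructor <;> linarith [h0 x, h1 x]
      have hsq : ‖a‖ * ‖a‖ ≤ A ^ 2 := by rw [sq]; exact mul_le_mul hA hA (norm_nonneg _) hA0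
      calc |χ x| * ‖oseenKernel σ (x - y) a a‖ ≤ 1 * (oseenMajorant (EuclideanSpace ℝ (Fin 3)) σ (x - y) * ‖a‖ * ‖a‖) :=
            mul_le_mul hχx1 hK (norm_nonneg _) zero_le_one
        _ = oseenMajorant (EuclideanSpace ℝ (Fin 3)) σ (x - y) * (‖a‖ * ‖a‖) := by ring
        _ ≤ (oseenKernelBoundConst (EuclideanSpace ℝ (Fin 3)) * ‖x - y‖ ^ (-(4 : ℝ))) * A ^ 2 :=
            mul_le_mul (oseenMajorant_le_norm_rpow_neg_four hσ.le hz) hsq (by positivity)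
              (mul_nonneg oseenKernelBoundConst_pos.le (Real.rpow_nonneg (norm_nonneg _) _))
        _ = oseenKernelBoundConst (EuclideanSpace ℝ (Fin 3)) * A ^ 2 * ‖x - y‖ ^ (-(4 : ℝ)) := by ring

/-- **THE FAR MASS**: `∫⁻ y, 1_{‖x−y‖ ≥ d}‖x−y‖⁻⁴ = 4π/d` (`d > 0`), in `ℝ≥0∞` form. [folklore] -/
theorem lintegral_indicator_compl_ball_sub_norm_rpow_neg_four {d : ℝ} (hd : 0 < d) (x : EuclideanSpace ℝ (Fin 3)) :
    ∫⁻ y, ENNReal.ofReal ((Metric.ball (0 : EuclideanSpace ℝ (Fin 3)) d)ᶜ.indicator (fun z => ‖z‖ ^ (-(4 : ℝ))) (x - y)) =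
      ENNReal.ofReal (4 * Real.pi / d) := by
  have hnn : ∀ z, 0 ≤ (Metric.ball (0 : EuclideanSpace ℝ (Fin 3)) d)ᶜ.indicator (fun z => ‖z‖ ^ (-(4 : ℝ))) z := fun z =>
    Set.indicator_nonneg (fun _ _ => Real.rpow_nonneg (norm_nonneg _) _) _
  rw [lintegral_sub_left_eq_self
      (fun z => ENNReal.ofReal ((Metric.ball (0 : EuclideanSpace ℝ (Fin 3)) d)ᶜ.indicator (fun z => ‖z‖ ^ (-(4 : ℝ))) z)) x,
    ← ofReal_integral_eq_lintegral_ofReal (integrable_indicator_compl_ball_norm_rpow_neg_four hd) (Eventually.of_forall hnn),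
    integral_indicator_compl_ball_norm_rpow_neg_four hd]

/-- **POINTWISE DOMINATION OF THE OSEEN COMMUTATOR BY THREE `L³`-CONTROLLED MAJORANTS**: under the hypotheses of
`norm_oseenCommutator_le` plus `χ = 0` off `B(0,ρ)`, `ρ < R`, for every `x`:
`‖O(t,x)‖ₑ ≤ Lχ^{1/2}·∫⁻∫⁻ k‖x−y‖^{1/2}F + η_c·∫⁻∫⁻ k·G + 1_{B(0,ρ)}(x)·C_K A²(4π/(R−ρ))·t`, with `F = 1_{B(0,R)}‖u‖²`,
`G = 1_{B(0,R)}‖u‖`, the double integrals over `(0,t) × ℝ³`. [folklore] -/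
theorem enorm_oseenCommutator_le_lintegral {u : ℝ → EuclideanSpace ℝ (Fin 3) → EuclideanSpace ℝ (Fin 3)}
    {χ : EuclideanSpace ℝ (Fin 3) → ℝ} {t Lχ A ηc ρ R : ℝ} (ht : 0 < t) (hχm : Measurable χ) (h0 : ∀ z, 0 ≤ χ z)
    (h1 : ∀ z, χ z ≤ 1) (hL : 0 ≤ Lχ) (hLip : ∀ x y, |χ x - χ y| ≤ Lχ * ‖x - y‖)
    (hχρ : ∀ z : EuclideanSpace ℝ (Fin 3), ρ ≤ ‖z‖ → χ z = 0) (hρR : ρ < R)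
    (hu : AEStronglyMeasurable (uncurry u) (volume.restrict (Ioo 0 t ×ˢ univ)))
    (huA : ∀ τ ∈ Ioo 0 t, ∀ y, ‖u τ y‖ ≤ A) (hηc : 0 ≤ ηc)
    (hquiet : ∀ τ ∈ Ioo 0 t, ∀ y, 0 < χ y → χ y < 1 → ‖u τ y‖ ≤ ηc) (x : EuclideanSpace ℝ (Fin 3)) :
    ‖χ x • oseenDuhamel 1 0 u u t x - oseenDuhamel 1 0 (fun τ y => χ y • u τ y) (fun τ y => χ y • u τ y) t x‖ₑ ≤
      ENNReal.ofReal (Lχ ^ (1 / 2 : ℝ)) *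
          (∫⁻ p, ENNReal.ofReal (oseenMajorant (EuclideanSpace ℝ (Fin 3)) (t - p.1) (x - p.2) * ‖x - p.2‖ ^ (1 / 2 : ℝ) *
              (Metric.ball (0 : EuclideanSpace ℝ (Fin 3)) R).indicator (fun y => ‖u p.1 y‖ ^ 2) p.2)
            ∂((volume.restrict (Ioo 0 t)).prod (volume : Measure (EuclideanSpace ℝ (Fin 3))))) +
        ENNReal.ofReal ηc *
          (∫⁻ p, ENNReal.ofReal (oseenMajorant (EuclideanSpace ℝ (Fin 3)) (t - p.1) (x - p.2) *
              (Metric.ball (0 : EuclideanSpace ℝ (Fin 3)) R).indicator (fun y => ‖u p.1 y‖) p.2)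
            ∂((volume.restrict (Ioo 0 t)).prod (volume : Measure (EuclideanSpace ℝ (Fin 3))))) +
        (Metric.ball (0 : EuclideanSpace ℝ (Fin 3)) ρ).indicator
          (fun _ => ENNReal.ofReal (oseenKernelBoundConst (EuclideanSpace ℝ (Fin 3)) * A ^ 2 * (4 * Real.pi / (R - ρ)) * t)) x := by
  have hA0 : 0 ≤ A := (norm_nonneg _).trans (huA (t / 2) ⟨by linarith, by linarith⟩ 0)
  have hχ1 : ∀ y, |χ y| ≤ 1 := fun y => by rw [abs_le]; constructor <;> linarith [h0 y, h1 y]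
  have hCK := oseenKernelBoundConst_pos (E := EuclideanSpace ℝ (Fin 3))
  set μ : Measure (ℝ × EuclideanSpace ℝ (Fin 3)) := (volume.restrict (Ioo 0 t)).prod volume with hμ
  set CK : ℝ := oseenKernelBoundConst (EuclideanSpace ℝ (Fin 3)) with hCKdef
  -- the three majorants on the product space
  set g₁ : ℝ × EuclideanSpace ℝ (Fin 3) → ℝ≥0∞ := fun p =>
    ENNReal.ofReal (oseenMajorant (EuclideanSpace ℝ (Fin 3)) (t - p.1) (x - p.2) * ‖x - p.2‖ ^ (1 / 2 : ℝ) *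
      (Metric.ball (0 : EuclideanSpace ℝ (Fin 3)) R).indicator (fun y => ‖u p.1 y‖ ^ 2) p.2) with hg₁
  set g₂ : ℝ × EuclideanSpace ℝ (Fin 3) → ℝ≥0∞ := fun p =>
    ENNReal.ofReal (oseenMajorant (EuclideanSpace ℝ (Fin 3)) (t - p.1) (x - p.2) *
      (Metric.ball (0 : EuclideanSpace ℝ (Fin 3)) R).indicator (fun y => ‖u p.1 y‖) p.2) with hg₂
  set g₃ : ℝ × EuclideanSpace ℝ (Fin 3) → ℝ≥0∞ := fun p =>
    ENNReal.ofReal ((Metric.ball (0 : EuclideanSpace ℝ (Fin 3)) (R - ρ))ᶜ.indicator (fun z => ‖z‖ ^ (-(4 : ℝ))) (x - p.2)) with hg₃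
  set c₃ : ℝ≥0∞ := (Metric.ball (0 : EuclideanSpace ℝ (Fin 3)) ρ).indicator (fun _ => ENNReal.ofReal (CK * A ^ 2)) x with hc₃
  -- the commutator as one integral
  rw [oseenCommutator_eq_integral_prod ht hu hχm huA hA0 hχ1 x]
  set Fi : ℝ × EuclideanSpace ℝ (Fin 3) → EuclideanSpace ℝ (Fin 3) := fun p =>
    (χ x - χ p.2 * χ p.2) • oseenKernel (1 * (t - p.1)) (x - p.2) (u p.1 p.2) (u p.1 p.2) with hFi
  -- pointwise domination a.e. (`p.1 ∈ (0,t)`)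
  have hae : ∀ᵐ p ∂μ, p.1 ∈ Ioo 0 t := by
    rw [hμ, Measure.restrict_prod_eq_prod_univ]
    filter_upwards [ae_restrict_mem (measurableSet_Ioo.prod MeasurableSet.univ)] with p hp
    exact hp.1
  have hdom : ∀ᵐ p ∂μ, ‖Fi p‖ₑ ≤ ENNReal.ofReal (Lχ ^ (1 / 2 : ℝ)) * g₁ p + ENNReal.ofReal ηc * g₂ p + c₃ * g₃ p := by
    filter_upwards [hae] with p hp
    have hσ : 0 < t - p.1 := sub_pos.2 hp.2
    have hreal := norm_commutatorIntegrand_le_three (σ := t - p.1) (ρ := ρ) (R := R) h0 h1 hL hLip hχρ hρR hσ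
      (huA p.1 hp p.2) hηc (fun hy0 hy1 => hquiet p.1 hp p.2 hy0 hy1) x
    rw [hFi]; simp only [one_mul]
    rw [← ofReal_norm]
    refine (ENNReal.ofReal_le_ofReal hreal).trans ?_
    have hn1 : 0 ≤ oseenMajorant (EuclideanSpace ℝ (Fin 3)) (t - p.1) (x - p.2) * ‖x - p.2‖ ^ (1 / 2 : ℝ) *
        (Metric.ball (0 : EuclideanSpace ℝ (Fin 3)) R).indicator (fun _ => ‖u p.1 p.2‖ ^ 2) p.2 := by
      have : 0 ≤ (Metric.ball (0 : EuclideanSpace ℝ (Fin 3)) R).indicator (fun _ => ‖u p.1 p.2‖ ^ 2) p.2 :=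
        Set.indicator_nonneg (fun _ _ => by positivity) _
      exact mul_nonneg (mul_nonneg (oseenMajorant_nonneg hσ.le _) (Real.rpow_nonneg (norm_nonneg _) _)) this
    have hn2 : 0 ≤ oseenMajorant (EuclideanSpace ℝ (Fin 3)) (t - p.1) (x - p.2) *
        (Metric.ball (0 : EuclideanSpace ℝ (Fin 3)) R).indicator (fun _ => ‖u p.1 p.2‖) p.2 :=
      mul_nonneg (oseenMajorant_nonneg hσ.le _) (Set.indicator_nonneg (fun _ _ => norm_nonneg _) _)
    have hn3 : 0 ≤ (Metric.ball (0 : EuclideanSpace ℝ (Fin 3)) (R - ρ))ᶜ.indicator (fun z => ‖z‖ ^ (-(4 : ℝ))) (x - p.2) :=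
      Set.indicator_nonneg (fun _ _ => Real.rpow_nonneg (norm_nonneg _) _) _
    have hA1 : 0 ≤ Lχ ^ (1 / 2 : ℝ) * (oseenMajorant (EuclideanSpace ℝ (Fin 3)) (t - p.1) (x - p.2) * ‖x - p.2‖ ^ (1 / 2 : ℝ) *
        (Metric.ball (0 : EuclideanSpace ℝ (Fin 3)) R).indicator (fun _ => ‖u p.1 p.2‖ ^ 2) p.2) :=
      mul_nonneg (Real.rpow_nonneg hL _) hn1
    have hA2 : 0 ≤ ηc * (oseenMajorant (EuclideanSpace ℝ (Fin 3)) (t - p.1) (x - p.2) *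
        (Metric.ball (0 : EuclideanSpace ℝ (Fin 3)) R).indicator (fun _ => ‖u p.1 p.2‖) p.2) := mul_nonneg hηc hn2
    have hA3 : 0 ≤ (Metric.ball (0 : EuclideanSpace ℝ (Fin 3)) ρ).indicator (fun _ => (1 : ℝ)) x *
        (oseenKernelBoundConst (EuclideanSpace ℝ (Fin 3)) * A ^ 2 *
          (Metric.ball (0 : EuclideanSpace ℝ (Fin 3)) (R - ρ))ᶜ.indicator (fun z => ‖z‖ ^ (-(4 : ℝ))) (x - p.2)) :=
      mul_nonneg (Set.indicator_nonneg (fun _ _ => zero_le_one) _) (mul_nonneg (by positivity) hn3)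
    rw [ENNReal.ofReal_add (add_nonneg hA1 hA2) hA3, ENNReal.ofReal_add hA1 hA2,
      ENNReal.ofReal_mul (Real.rpow_nonneg hL _), ENNReal.ofReal_mul hηc]
    -- identify the indicator forms
    have hi1 : (Metric.ball (0 : EuclideanSpace ℝ (Fin 3)) R).indicator (fun _ => ‖u p.1 p.2‖ ^ 2) p.2 =
        (Metric.ball (0 : EuclideanSpace ℝ (Fin 3)) R).indicator (fun y => ‖u p.1 y‖ ^ 2) p.2 := by
      by_cases h : p.2 ∈ Metric.ball (0 : EuclideanSpace ℝ (Fin 3)) R <;> simp [h]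
    have hi2 : (Metric.ball (0 : EuclideanSpace ℝ (Fin 3)) R).indicator (fun _ => ‖u p.1 p.2‖) p.2 =
        (Metric.ball (0 : EuclideanSpace ℝ (Fin 3)) R).indicator (fun y => ‖u p.1 y‖) p.2 := by
      by_cases h : p.2 ∈ Metric.ball (0 : EuclideanSpace ℝ (Fin 3)) R <;> simp [h]
    rw [hi1, hi2]
    refine add_le_add le_rfl ?_
    -- the far term: `1_{B(0,ρ)}(x)·(C_K A²·1_{..}‖x−y‖⁻⁴)`
    rw [hc₃, hg₃]
    by_cases hx : x ∈ Metric.ball (0 : EuclideanSpace ℝ (Fin 3)) ρ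
    · rw [Set.indicator_of_mem hx, Set.indicator_of_mem hx, one_mul, ← ENNReal.ofReal_mul (by positivity)]
    · rw [Set.indicator_of_notMem hx, Set.indicator_of_notMem hx, zero_mul, zero_mul, ENNReal.ofReal_zero]
  -- measurability of the majorants
  have hu' : AEStronglyMeasurable (uncurry u) μ := by
    rw [hμ, Measure.restrict_prod_eq_prod_univ, ← Measure.volume_eq_prod]; exact hu
  have hkm : Measurable fun p : ℝ × EuclideanSpace ℝ (Fin 3) => oseenMajorant (EuclideanSpace ℝ (Fin 3)) (t - p.1) (x - p.2) :=
    measurable_oseenMajorant_uncurry.comp ((measurable_const.sub measurable_fst).prodMk (measurable_const.sub measurable_snd))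
  have hsetR : MeasurableSet {p : ℝ × EuclideanSpace ℝ (Fin 3) | p.2 ∈ Metric.ball (0 : EuclideanSpace ℝ (Fin 3)) R} :=
    measurableSet_ball.preimage measurable_snd
  have hFeq : (fun p : ℝ × EuclideanSpace ℝ (Fin 3) =>
      (Metric.ball (0 : EuclideanSpace ℝ (Fin 3)) R).indicator (fun y => ‖u p.1 y‖ ^ 2) p.2) =
      {p : ℝ × EuclideanSpace ℝ (Fin 3) | p.2 ∈ Metric.ball (0 : EuclideanSpace ℝ (Fin 3)) R}.indicator
        (fun p => ‖uncurry u p‖ ^ 2) := by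
    funext p
    by_cases hp : p.2 ∈ Metric.ball (0 : EuclideanSpace ℝ (Fin 3)) R
    · rw [Set.indicator_of_mem hp,
        Set.indicator_of_mem (show p ∈ {q : ℝ × EuclideanSpace ℝ (Fin 3) | q.2 ∈ Metric.ball (0 : EuclideanSpace ℝ (Fin 3)) R}
          from hp)]
      rfl
    · rw [Set.indicator_of_notMem hp,
        Set.indicator_of_notMem (show p ∉ {q : ℝ × EuclideanSpace ℝ (Fin 3) | q.2 ∈ Metric.ball (0 : EuclideanSpace ℝ (Fin 3)) R}
          from hp)]
  have hGeq : (fun p : ℝ × EuclideanSpace ℝ (Fin 3) =>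
      (Metric.ball (0 : EuclideanSpace ℝ (Fin 3)) R).indicator (fun y => ‖u p.1 y‖) p.2) =
      {p : ℝ × EuclideanSpace ℝ (Fin 3) | p.2 ∈ Metric.ball (0 : EuclideanSpace ℝ (Fin 3)) R}.indicator
        (fun p => ‖uncurry u p‖) := by
    funext p
    by_cases hp : p.2 ∈ Metric.ball (0 : EuclideanSpace ℝ (Fin 3)) R
    · rw [Set.indicator_of_mem hp,
        Set.indicator_of_mem (show p ∈ {q : ℝ × EuclideanSpace ℝ (Fin 3) | q.2 ∈ Metric.ball (0 : EuclideanSpace ℝ (Fin 3)) R}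
          from hp)]
      rfl
    · rw [Set.indicator_of_notMem hp,
        Set.indicator_of_notMem (show p ∉ {q : ℝ × EuclideanSpace ℝ (Fin 3) | q.2 ∈ Metric.ball (0 : EuclideanSpace ℝ (Fin 3)) R}
          from hp)]
  have hF : AEMeasurable (fun p : ℝ × EuclideanSpace ℝ (Fin 3) =>
      (Metric.ball (0 : EuclideanSpace ℝ (Fin 3)) R).indicator (fun y => ‖u p.1 y‖ ^ 2) p.2) μ := by
    rw [hFeq]; exact (hu'.norm.aemeasurable.pow_const 2).indicator hsetR
  have hG : AEMeasurable (fun p : ℝ × EuclideanSpace ℝ (Fin 3) =>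
      (Metric.ball (0 : EuclideanSpace ℝ (Fin 3)) R).indicator (fun y => ‖u p.1 y‖) p.2) μ := by
    rw [hGeq]; exact hu'.norm.aemeasurable.indicator hsetR
  have hg₁m : AEMeasurable g₁ μ :=
    ((hkm.mul ((measurable_const.sub measurable_snd).norm.pow_const _)).aemeasurable.mul hF).ennreal_ofReal
  have hg₂m : AEMeasurable g₂ μ := (hkm.aemeasurable.mul hG).ennreal_ofReal
  have hg₃m : Measurable g₃ := by
    have h : Measurable fun z : EuclideanSpace ℝ (Fin 3) =>
        (Metric.ball (0 : EuclideanSpace ℝ (Fin 3)) (R - ρ))ᶜ.indicator (fun z => ‖z‖ ^ (-(4 : ℝ))) z :=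
      (measurable_norm.pow_const _).indicator measurableSet_ball.compl
    exact (h.comp (measurable_const.sub measurable_snd)).ennreal_ofReal
  -- integrate
  have hint3 : ∫⁻ p, g₃ p ∂μ = ENNReal.ofReal (4 * Real.pi / (R - ρ)) * ENNReal.ofReal t := by
    rw [hμ, lintegral_prod _ hg₃m.aemeasurable]
    have hin : ∀ τ : ℝ, ∫⁻ y, g₃ (τ, y) = ENNReal.ofReal (4 * Real.pi / (R - ρ)) := fun τ =>
      lintegral_indicator_compl_ball_sub_norm_rpow_neg_four (sub_pos.2 hρR) x
    simp only [hin]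
    rw [setLIntegral_const, Real.volume_Ioo, sub_zero]
  calc ‖∫ p, Fi p ∂μ‖ₑ ≤ ∫⁻ p, ‖Fi p‖ₑ ∂μ := enorm_integral_le_lintegral_enorm _
    _ ≤ ∫⁻ p, (ENNReal.ofReal (Lχ ^ (1 / 2 : ℝ)) * g₁ p + ENNReal.ofReal ηc * g₂ p + c₃ * g₃ p) ∂μ := lintegral_mono_ae hdom
    _ = ENNReal.ofReal (Lχ ^ (1 / 2 : ℝ)) * ∫⁻ p, g₁ p ∂μ + ENNReal.ofReal ηc * ∫⁻ p, g₂ p ∂μ + c₃ * ∫⁻ p, g₃ p ∂μ := by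
        rw [lintegral_add_right' _ (hg₃m.aemeasurable.const_mul _), lintegral_add_left' (hg₁m.const_mul _),
          lintegral_const_mul'' _ hg₁m, lintegral_const_mul'' _ hg₂m, lintegral_const_mul'' _ hg₃m.aemeasurable]
    _ = _ := by
        rw [hint3, hc₃]
        congr 1
        by_cases hx : x ∈ Metric.ball (0 : EuclideanSpace ℝ (Fin 3)) ρ
        · rw [Set.indicator_of_mem hx, Set.indicator_of_mem hx, ← ENNReal.ofReal_mul (by positivity),
            ← ENNReal.ofReal_mul (by positivity)]
          congr 1; ring
        · rw [Set.indicator_of_notMem hx, Set.indicator_of_notMem hx, zero_mul]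

end Summit.NavierStokesRegularity.NavierStokesRegularity.Cruxes.TypeIQuantSubcubicExp.QuietCollar

end
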